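import Mathlib
import HarnessLib
import Literature.Analysis.SegalBargmann.SchwartzChirpDerivative

/-!
# LatticeQCDFlow / Scaling — third-order Taylor bounds for `e^{ix}`, for the characteristic function
# and for the moment generating function of a bounded centred statistic

HONEST FRAMING: exact (Metropolis-corrected) sampling algorithms for lattice gauge theory;
figures of merit are autocorrelation/cost numbers at stated couplings and volumes; no
continuum-physics claim.

Venture `LatticeQCDFlow` (cell pub-lqcd), topic `Scaling`; FANOUT row 3 (`s0-u1-a`, S0-B
implementation A, GEN-19).  NEW WORK of the cell (elementary analysis on Mathlib: mean-value bounds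
along the chord `s ↦ e^{isx}` from `Real.norm_exp_I_mul_ofReal_sub_one_le`, and `Real.exp_bound`);
NO definition is introduced; nothing is cited.  These are the explicit (Lyapunov-type) estimates
behind row 3's TRIANGULAR central limit theorem for the rows of product families
(`Scaling/TriangularRowCLT`) and the log-normal universality of factorised flow samplers; the
constants are crude (`1` where `1/2`, `1/6`, `2/9` are sharp) — only limits are drawn from them.

## Content (all `[ours]`)

* §1 `hasDerivAt_cexp_ofReal_mul` (the tree's `Literature.Analysis.SegalBargmann.norm_cexp_ofReal_mul_I_sub_one_le`
  `‖e^{ix} − 1‖ ≤ |x|` is REUSED, not restated),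
  `norm_cexp_mul_I_sub_one_sub_le` (`‖e^{ix} − 1 − ix‖ ≤ x²`),
  **`norm_cexp_mul_I_sub_taylor_two_le`** (`‖e^{ix} − 1 − ix + x²/2‖ ≤ |x|³`);
* §2 **`norm_charFun_map_sub_taylor_le`** — `h` bounded (`|h| ≤ K`) and centred under a probability
  law `ρ`: `‖φ_{ρ∘h⁻¹}(u) − (1 − u²·Var h/2)‖ ≤ |u|³K³`;
  **`abs_mgf_sub_taylor_le`** — `|M(u) − (1 + u²·Var h/2)| ≤ |u|³K³` for `|u|K ≤ 1`.

NOT CLAIMED: sharp constants; unbounded statistics.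
-/

noncomputable section

namespace Summit.Ventures.LatticeQCDFlow.Theory2

open MeasureTheory ProbabilityTheory Filter Finset Real Set Complex
open scoped Topology NNReal

/-! ## §1 Third-order Taylor bound for `e^{ix}` -/

section Taylor

/-- The chord `s ↦ e^{isx}` has derivative `ix·e^{isx}`. [folklore] -/
theorem hasDerivAt_cexp_ofReal_mul (x s : ℝ) :
    HasDerivAt (fun r : ℝ => Complex.exp ((r : ℂ) * ((x : ℂ) * I)))
      (((x : ℂ) * I) * Complex.exp ((s : ℂ) * ((x : ℂ) * I))) s := by
  have h1 : HasDerivAt (fun r : ℝ => (r : ℂ) * ((x : ℂ) * I)) ((1 : ℂ) * ((x : ℂ) * I)) s :=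
    (Complex.ofRealCLM.hasDerivAt).mul_const _
  have h2 := h1.cexp
  simp only [one_mul] at h2
  refine h2.congr_deriv ?_
  ring

/-- `‖e^{ix} − 1 − ix‖ ≤ x²` for real `x` (crude constant; mean-value bound along the chord).
[folklore] -/
theorem norm_cexp_mul_I_sub_one_sub_le (x : ℝ) :
    ‖Complex.exp ((x : ℂ) * I) - 1 - (x : ℂ) * I‖ ≤ x ^ 2 := by
  -- `f(s) = e^{isx} − s·ix`, `f′(s) = ix(e^{isx} − 1)`, `‖f′(s)‖ ≤ |x|·|s x| ≤ x²` on `[0,1]`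
  let f : ℝ → ℂ := fun r => Complex.exp ((r : ℂ) * ((x : ℂ) * I)) - (r : ℂ) * ((x : ℂ) * I)
  have hf : ∀ r ∈ Set.Icc (0 : ℝ) 1, HasDerivWithinAt f
      (((x : ℂ) * I) * (Complex.exp ((r : ℂ) * ((x : ℂ) * I)) - 1)) (Set.Icc (0 : ℝ) 1) r := by
    intro r _
    have h1 := hasDerivAt_cexp_ofReal_mul x r
    have h2 : HasDerivAt (fun r : ℝ => (r : ℂ) * ((x : ℂ) * I)) ((1 : ℂ) * ((x : ℂ) * I)) r :=
      (Complex.ofRealCLM.hasDerivAt).mul_const _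
    have h := h1.sub h2
    refine (h.congr_deriv ?_).hasDerivWithinAt
    ring
  have bound : ∀ r ∈ Set.Ico (0 : ℝ) 1,
      ‖((x : ℂ) * I) * (Complex.exp ((r : ℂ) * ((x : ℂ) * I)) - 1)‖ ≤ x ^ 2 := by
    intro r hr
    rw [norm_mul]
    have hxI : ‖(x : ℂ) * I‖ = |x| := by simp
    rw [hxI]
    have h := Literature.Analysis.SegalBargmann.norm_cexp_ofReal_mul_I_sub_one_le (r * x)
    push_cast at h
    rw [show ((r : ℂ) * (x : ℂ)) * I = (r : ℂ) * ((x : ℂ) * I) by ring] at h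
    calc |x| * ‖Complex.exp ((r : ℂ) * ((x : ℂ) * I)) - 1‖ ≤ |x| * |r * x| :=
          mul_le_mul_of_nonneg_left h (abs_nonneg x)
      _ = |r| * x ^ 2 := by rw [abs_mul, ← sq_abs x]; ring
      _ ≤ 1 * x ^ 2 := by
          refine mul_le_mul_of_nonneg_right ?_ (sq_nonneg x)
          rw [abs_le]; exact ⟨by linarith [hr.1], hr.2.le⟩
      _ = x ^ 2 := one_mul _
  have key := norm_image_sub_le_of_norm_deriv_le_segment_01' hf bound
  have e1 : f 1 = Complex.exp ((x : ℂ) * I) - (x : ℂ) * I := by simp [f]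
  have e0 : f 0 = 1 := by simp [f]
  rw [e1, e0] at key
  simpa [sub_right_comm] using key

/-- **`‖e^{ix} − 1 − ix + x²/2‖ ≤ |x|³`** for real `x` (crude constant, enough for the central limit
theorem; the sharp constant is `1/6`). [folklore] -/
theorem norm_cexp_mul_I_sub_taylor_two_le (x : ℝ) :
    ‖Complex.exp ((x : ℂ) * I) - 1 - (x : ℂ) * I + (x : ℂ) ^ 2 / 2‖ ≤ |x| ^ 3 := by
  let g : ℝ → ℂ := fun r => Complex.exp ((r : ℂ) * ((x : ℂ) * I)) - (r : ℂ) * ((x : ℂ) * I)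
    + ((r : ℂ) * (x : ℂ)) ^ 2 / 2
  have hg : ∀ r ∈ Set.Icc (0 : ℝ) 1, HasDerivWithinAt g
      (((x : ℂ) * I) * (Complex.exp ((r : ℂ) * ((x : ℂ) * I)) - 1 - (r : ℂ) * ((x : ℂ) * I)))
      (Set.Icc (0 : ℝ) 1) r := by
    intro r _
    have h1 := hasDerivAt_cexp_ofReal_mul x r
    have h2 : HasDerivAt (fun r : ℝ => (r : ℂ) * ((x : ℂ) * I)) ((1 : ℂ) * ((x : ℂ) * I)) r :=
      (Complex.ofRealCLM.hasDerivAt).mul_const _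
    have h3 : HasDerivAt (fun r : ℝ => ((r : ℂ) * (x : ℂ)) ^ 2 / 2)
        (((2 : ℕ) : ℂ) * ((r : ℂ) * (x : ℂ)) ^ (2 - 1) * ((1 : ℂ) * (x : ℂ)) / 2) r :=
      (((Complex.ofRealCLM.hasDerivAt).mul_const (x : ℂ)).pow 2).div_const 2
    have h := (h1.sub h2).add h3
    refine (h.congr_deriv ?_).hasDerivWithinAt
    simp only [Nat.cast_ofNat, pow_one, Nat.add_one_sub_one]
    ring_nf
    rw [Complex.I_sq]
    ring
  have bound : ∀ r ∈ Set.Ico (0 : ℝ) 1,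
      ‖((x : ℂ) * I) * (Complex.exp ((r : ℂ) * ((x : ℂ) * I)) - 1 - (r : ℂ) * ((x : ℂ) * I))‖
        ≤ |x| ^ 3 := by
    intro r hr
    rw [norm_mul]
    have hxI : ‖(x : ℂ) * I‖ = |x| := by simp
    rw [hxI]
    have h := norm_cexp_mul_I_sub_one_sub_le (r * x)
    push_cast at h
    rw [show ((r : ℂ) * (x : ℂ)) * I = (r : ℂ) * ((x : ℂ) * I) by ring] at h
    have hr1 : r ^ 2 ≤ 1 := by
      have : |r| ≤ 1 := abs_le.2 ⟨by linarith [hr.1], hr.2.le⟩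
      calc r ^ 2 = |r| ^ 2 := (sq_abs r).symm
        _ ≤ 1 ^ 2 := pow_le_pow_left₀ (abs_nonneg r) this 2
        _ = 1 := one_pow 2
    calc |x| * ‖Complex.exp ((r : ℂ) * ((x : ℂ) * I)) - 1 - (r : ℂ) * ((x : ℂ) * I)‖
        ≤ |x| * (r * x) ^ 2 := mul_le_mul_of_nonneg_left h (abs_nonneg x)
      _ = r ^ 2 * (|x| * x ^ 2) := by ring
      _ ≤ 1 * (|x| * x ^ 2) := mul_le_mul_of_nonneg_right hr1 (by positivity)
      _ = |x| ^ 3 := by rw [one_mul, ← sq_abs x]; ring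
  have key := norm_image_sub_le_of_norm_deriv_le_segment_01' hg bound
  have e1 : g 1 = Complex.exp ((x : ℂ) * I) - (x : ℂ) * I + (x : ℂ) ^ 2 / 2 := by simp [g]
  have e0 : g 0 = 1 := by simp [g]
  rw [e1, e0] at key
  have e : Complex.exp ((x : ℂ) * I) - (x : ℂ) * I + (x : ℂ) ^ 2 / 2 - 1
      = Complex.exp ((x : ℂ) * I) - 1 - (x : ℂ) * I + (x : ℂ) ^ 2 / 2 := by ring
  rw [e] at key
  exact key

end Taylor

/-! ## §2 Third-order bound on the characteristic function of a bounded centred statistic -/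

section CharFunBound

variable {Y : Type*} {mY : MeasurableSpace Y} (ρ : Measure Y) [IsProbabilityMeasure ρ] {h : Y → ℝ}

/-- **`‖φ(u) − (1 − u²σ²/2)‖ ≤ |u|³K³`** for the law of a bounded centred statistic `h` (`|h| ≤ K`,
`∫ h dρ = 0`, `σ² = Var h`). [ours] -/
theorem norm_charFun_map_sub_taylor_le (hm : Measurable h) {K : ℝ} (hK : ∀ y, |h y| ≤ K)
    (h0 : ∫ y, h y ∂ρ = 0) (u : ℝ) :
    ‖charFun (ρ.map h) u - (1 - (u ^ 2 * Var[h; ρ] / 2 : ℝ) : ℂ)‖ ≤ |u| ^ 3 * K ^ 3 := by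
  have hK0 : 0 ≤ K := (abs_nonneg _).trans (hK (Classical.choice (by
    by_contra hne; rw [not_nonempty_iff] at hne
    exact absurd (IsProbabilityMeasure.measure_univ (μ := ρ)) (by simp [Set.univ_eq_empty_iff.2 hne]))))
  have hb : ∀ᵐ y ∂ρ, h y ∈ Set.Icc (-K) K := ae_of_all _ fun y => abs_le.1 (hK y)
  have hi : Integrable h ρ := Integrable.of_mem_Icc (-K) K hm.aemeasurable hb
  have hi2 : Integrable (fun y => h y ^ 2) ρ :=
    (memLp_of_bounded hb hm.aestronglyMeasurable 2).integrable_sq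
  have hvar : Var[h; ρ] = ∫ y, h y ^ 2 ∂ρ := by
    rw [variance_eq_integral hm.aemeasurable, h0]; simp
  -- the characteristic function as an integral over `ρ`
  have hcf : charFun (ρ.map h) u = ∫ y, Complex.exp (((u * h y : ℝ) : ℂ) * I) ∂ρ := by
    rw [charFun_apply_real, integral_map hm.aemeasurable (by fun_prop)]
    refine integral_congr_ae (ae_of_all _ fun y => ?_)
    push_cast; ring_nf
  -- the remainder
  set R : Y → ℂ := fun y => Complex.exp (((u * h y : ℝ) : ℂ) * I) - 1 - ((u * h y : ℝ) : ℂ) * I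
    + (((u * h y : ℝ) : ℂ)) ^ 2 / 2 with hR
  have hRb : ∀ y, ‖R y‖ ≤ |u| ^ 3 * K ^ 3 := fun y => by
    refine (norm_cexp_mul_I_sub_taylor_two_le (u * h y)).trans ?_
    rw [abs_mul, mul_pow]
    exact mul_le_mul_of_nonneg_left (pow_le_pow_left₀ (abs_nonneg _) (hK y) 3) (by positivity)
  -- integrability of the pieces
  have iE : Integrable (fun y => Complex.exp (((u * h y : ℝ) : ℂ) * I)) ρ := by
    refine (integrable_const (1 : ℝ)).mono' (by fun_prop) (ae_of_all _ fun y => ?_)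
    rw [Complex.norm_exp_ofReal_mul_I]
  have iL : Integrable (fun y => ((u * h y : ℝ) : ℂ) * I) ρ :=
    ((hi.const_mul u).ofReal).mul_const I
  have iQ : Integrable (fun y => (((u * h y : ℝ) : ℂ)) ^ 2 / 2) ρ := by
    have : Integrable (fun y => ((u ^ 2 * h y ^ 2 / 2 : ℝ) : ℂ)) ρ :=
      ((hi2.const_mul (u ^ 2)).div_const 2).ofReal
    refine this.congr (ae_of_all _ fun y => ?_)
    push_cast; ring
  have i1 : Integrable (fun y => Complex.exp (((u * h y : ℝ) : ℂ) * I) - 1) ρ :=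
    iE.sub' (integrable_const _)
  have i2 : Integrable (fun y => Complex.exp (((u * h y : ℝ) : ℂ) * I) - 1 - ((u * h y : ℝ) : ℂ) * I) ρ :=
    i1.sub' iL
  have hint : ∫ y, R y ∂ρ = charFun (ρ.map h) u - (1 - (u ^ 2 * Var[h; ρ] / 2 : ℝ) : ℂ) := by
    simp only [hR]
    rw [integral_add i2 iQ, integral_sub i1 iL, integral_sub iE (integrable_const _), hcf, integral_const]
    simp only [probReal_univ, one_smul]
    -- linear term vanishes, quadratic term is `u²σ²/2`
    have hlin : ∫ y, ((u * h y : ℝ) : ℂ) * I ∂ρ = 0 := by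
      rw [integral_mul_const, integral_complex_ofReal, integral_const_mul, h0]; simp
    have hquad : ∫ y, (((u * h y : ℝ) : ℂ)) ^ 2 / 2 ∂ρ = ((u ^ 2 * Var[h; ρ] / 2 : ℝ) : ℂ) := by
      have e : (fun y => (((u * h y : ℝ) : ℂ)) ^ 2 / 2) = fun y => (((u ^ 2 * (h y ^ 2) / 2 : ℝ)) : ℂ) := by
        funext y; push_cast; ring
      rw [e, integral_complex_ofReal, integral_div, integral_const_mul, hvar]
    rw [hlin, hquad]
    push_cast
    ring
  rw [← hint]
  calc ‖∫ y, R y ∂ρ‖ ≤ ∫ y, ‖R y‖ ∂ρ := norm_integral_le_integral_norm _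
    _ ≤ ∫ _y, |u| ^ 3 * K ^ 3 ∂ρ :=
        integral_mono_of_nonneg (ae_of_all _ fun y => norm_nonneg _) (integrable_const _)
          (ae_of_all _ hRb)
    _ = |u| ^ 3 * K ^ 3 := by simp

end CharFunBound


/-! ## §3 Third-order bound on the moment generating function -/

section MGFBound

variable {Y : Type*} {mY : MeasurableSpace Y}

/-- **`|M(u) − 1 − u²σ²/2| ≤ |u|³K³`** for the moment generating function of a bounded centred
statistic (`|h| ≤ K`, `|u|K ≤ 1`; Mathlib's `Real.exp_bound` at order three, integrated). [ours] -/
theorem abs_mgf_sub_taylor_le (ρ : Measure Y) [IsProbabilityMeasure ρ] {h : Y → ℝ} (hm : Measurable h)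
    {K : ℝ} (hK : ∀ y, |h y| ≤ K) (h0 : ∫ y, h y ∂ρ = 0) {u : ℝ} (hu : |u| * K ≤ 1) :
    |mgf h ρ u - (1 + u ^ 2 * Var[h; ρ] / 2)| ≤ |u| ^ 3 * K ^ 3 := by
  have hb : ∀ᵐ y ∂ρ, h y ∈ Set.Icc (-K) K := ae_of_all _ fun y => abs_le.1 (hK y)
  have hi : Integrable h ρ := Integrable.of_mem_Icc (-K) K hm.aemeasurable hb
  have hi2 : Integrable (fun y => h y ^ 2) ρ :=
    (memLp_of_bounded hb hm.aestronglyMeasurable 2).integrable_sq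
  have hiE : Integrable (fun y => Real.exp (u * h y)) ρ := integrable_exp_mul_of_mem_Icc hm.aemeasurable hb
  have hvar : Var[h; ρ] = ∫ y, h y ^ 2 ∂ρ := by
    rw [variance_eq_integral hm.aemeasurable, h0]; simp
  -- pointwise third-order bound, `|u h y| ≤ |u| K ≤ 1`
  have hpt : ∀ y, |Real.exp (u * h y) - (1 + u * h y + (u * h y) ^ 2 / 2)| ≤ |u| ^ 3 * K ^ 3 := by
    intro y
    have hx : |u * h y| ≤ 1 := by
      rw [abs_mul]; exact (mul_le_mul_of_nonneg_left (hK y) (abs_nonneg u)).trans hu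
    have hB := Real.exp_bound hx (n := 3) (by norm_num)
    have hsum : ∑ m ∈ range 3, (u * h y) ^ m / (m.factorial : ℝ) = 1 + u * h y + (u * h y) ^ 2 / 2 := by
      simp [Finset.sum_range_succ, Nat.factorial]
    rw [hsum] at hB
    refine hB.trans ?_
    have h3 : |u * h y| ^ 3 ≤ |u| ^ 3 * K ^ 3 := by
      rw [abs_mul, mul_pow]
      exact mul_le_mul_of_nonneg_left (pow_le_pow_left₀ (abs_nonneg _) (hK y) 3) (by positivity)
    have hc : ((Nat.succ 3 : ℕ) : ℝ) / ((Nat.factorial 3 : ℕ) * (3 : ℕ) : ℝ) ≤ 1 := by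
      norm_num [Nat.factorial]
    calc |u * h y| ^ 3 * ((Nat.succ 3 : ℕ) / ((Nat.factorial 3 : ℕ) * (3 : ℕ) : ℝ))
        ≤ |u * h y| ^ 3 * 1 := mul_le_mul_of_nonneg_left hc (by positivity)
      _ ≤ |u| ^ 3 * K ^ 3 := by rw [mul_one]; exact h3
  -- integrate
  have hI : mgf h ρ u - (1 + u ^ 2 * Var[h; ρ] / 2)
      = ∫ y, (Real.exp (u * h y) - (1 + u * h y + (u * h y) ^ 2 / 2)) ∂ρ := by
    have iP : Integrable (fun y => 1 + u * h y + (u * h y) ^ 2 / 2) ρ := by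
      have : Integrable (fun y => 1 + u * h y + u ^ 2 * h y ^ 2 / 2) ρ :=
        ((integrable_const 1).add (hi.const_mul u)).add ((hi2.const_mul (u ^ 2)).div_const 2)
      exact this.congr (ae_of_all _ fun y => by ring)
    rw [integral_sub hiE iP, mgf]
    congr 1
    have e : (fun y => 1 + u * h y + (u * h y) ^ 2 / 2) = fun y => 1 + u * h y + u ^ 2 * h y ^ 2 / 2 := by
      funext y; ring
    rw [e, integral_add ((integrable_const 1).fun_add (hi.const_mul u)) ((hi2.const_mul (u ^ 2)).div_const 2),
      integral_add (integrable_const 1) (hi.const_mul u), integral_const, integral_const_mul, h0,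
      integral_div, integral_const_mul, hvar]
    simp
  rw [hI]
  calc |∫ y, (Real.exp (u * h y) - (1 + u * h y + (u * h y) ^ 2 / 2)) ∂ρ|
      ≤ ∫ y, |Real.exp (u * h y) - (1 + u * h y + (u * h y) ^ 2 / 2)| ∂ρ := abs_integral_le_integral_abs
    _ ≤ ∫ _y, |u| ^ 3 * K ^ 3 ∂ρ :=
        integral_mono_of_nonneg (ae_of_all _ fun y => abs_nonneg _) (integrable_const _) (ae_of_all _ hpt)
    _ = |u| ^ 3 * K ^ 3 := by simp

end MGFBound

end Summit.Ventures.LatticeQCDFlow.Theory2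

end
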